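import Mathlib
import Summits.Ventures.PercRepro2.TB14Fold

/-!
# Typed BHK 1.4 (single-vertex) when `a₁` separates `b` from `a₂`: an equality
(blind cell PercRepro2, mine-c g13, 2026-08-25; MINE-C.md §22.3–22.4; the first class theorem of
row 2′TB from the junction reduction `tb14_slack_eq_junction`)

`offRoot ends a₁` is the configuration with every edge at `a₁` closed and every other edge open;
`¬ Conn ends (offRoot ends a₁) a₂ b` says that every path of the graph from `a₂` to `b` passes
through `a₁` (`a₁` is a cut vertex separating `b` from `a₂`; in particular `b` a leaf at `a₁`).
* `cluster_subset_offRoot`: under `a₂ ↮ a₁` the cluster of `a₂` lies in the component of `a₂`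
  of the graph minus `a₁`; hence the region of `a₂` does (`region_subset_offRoot`).
* `conn_swapRegion_of_sep`: the red connection `a₁ ↔ b` survives the region swap `ι₂`.
* **`tb14_of_sep`**: `N(QAB, Q) = N(QB, QA)` at every profile — typed BHK 1.4 for single-vertex
  events holds with EQUALITY whenever `a₁` separates `b` from `a₂`.
* **`TB14_iff_junction`**: the Prop `TB14` is equivalent to «the junction count is `≤ 0` at every
  profile» — the statement of record of the open part of row 2′TB.
Axioms: standard.
-/

namespace Summit.Ventures.PercRepro2

namespace TB14Fold

open CovForm A3InactiveTyped

section Cut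

variable {V : Type} {E : Type} [Fintype E] [DecidableEq E]

open Classical in
/-- The configuration with every edge at `a₁` closed and every other edge open. -/
noncomputable def offRoot (ends : E → Sym2 V) (a₁ : V) : Config E :=
  fun e => decide (a₁ ∉ ends e)

omit [Fintype E] [DecidableEq E] in
/-- An edge not at `a₁` is open in `offRoot`. -/
lemma offRoot_eq_true {ends : E → Sym2 V} {a₁ : V} {e : E} (h : a₁ ∉ ends e) :
    offRoot ends a₁ e = true := by
  simp [offRoot, h]

omit [Fintype E] [DecidableEq E] in
/-- An open edge of `offRoot` is not at `a₁`. -/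
lemma notMem_of_offRoot {ends : E → Sym2 V} {a₁ : V} {e : E} (h : offRoot ends a₁ e = true) :
    a₁ ∉ ends e := by
  by_contra h'
  simp [offRoot, h'] at h

omit [Fintype E] [DecidableEq E] in
/-- `a₁` is isolated in `offRoot`: its cluster from `a₂ ≠ a₁` never contains it. -/
lemma notMem_cluster_offRoot {ends : E → Sym2 V} {a₁ a₂ : V} (h : a₂ ≠ a₁) :
    a₁ ∉ cluster ends (offRoot ends a₁) a₂ := by
  intro hmem
  have : a₁ ∈ ({v | v ≠ a₁} : Set V) := by
    refine mem_of_conn_of_closed (S := {v | v ≠ a₁}) ?_ h hmem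
    intro x hx u hxu
    obtain ⟨_, e, he, hends⟩ := openGraph_adj.1 hxu
    have hne : a₁ ∉ ends e := notMem_of_offRoot he
    intro hu
    apply hne
    rw [hends, hu]
    exact Sym2.mem_mk_right x a₁
  exact this rfl

omit [Fintype E] [DecidableEq E] in
/-- Under `a₂ ↮ a₁`, the cluster of `a₂` lies in the component of `a₂` in the graph minus `a₁`. -/
lemma cluster_subset_offRoot {ends : E → Sym2 V} {a₁ a₂ : V} {y : Config E}
    (hQ : ¬ Conn ends y a₂ a₁) :
    cluster ends y a₂ ⊆ cluster ends (offRoot ends a₁) a₂ := by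
  intro v hv
  have hmem : v ∈ cluster ends y a₂ ∩ cluster ends (offRoot ends a₁) a₂ := by
    refine mem_of_conn_of_closed
      (S := cluster ends y a₂ ∩ cluster ends (offRoot ends a₁) a₂) ?_
      ⟨mem_cluster_self ends y a₂, mem_cluster_self ends _ a₂⟩ hv
    intro x hx u hxu
    obtain ⟨hne, e, he, hends⟩ := openGraph_adj.1 hxu
    have hu : u ∈ cluster ends y a₂ := mem_cluster_of_adj hx.1 hxu
    refine ⟨hu, ?_⟩
    have hnot : a₁ ∉ ends e := by
      intro ha
      rw [hends, Sym2.mem_iff] at ha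
      rcases ha with rfl | rfl
      · exact hQ hx.1
      · exact hQ hu
    exact mem_cluster_of_adj hx.2 (openGraph_adj.2 ⟨hne, e, offRoot_eq_true hnot, hends⟩)
  exact hmem.2

omit [Fintype E] in
/-- Under `a₂ ↮ a₁` in both copies, the region of `a₂` lies in the component of `a₂` in the graph
minus `a₁`. -/
lemma region_subset_offRoot {ends : E → Sym2 V} {F : Finset E} {a₁ a₂ : V} {y : Config E}
    (hQ : ¬ Conn ends y a₂ a₁) (hQ' : ¬ Conn ends (A3InactiveTyped.flipOn F y) a₂ a₁) :
    region ends F a₂ y ⊆ cluster ends (offRoot ends a₁) a₂ := by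
  rintro v (hv | hv)
  · exact cluster_subset_offRoot hQ hv
  · exact cluster_subset_offRoot hQ' hv

omit [Fintype E] in
/-- A region edge is a free edge with an endpoint in the region. -/
lemma mem_regionEdges_iff {ends : E → Sym2 V} {F : Finset E} {a₂ : V} {y : Config E} {e : E} :
    e ∈ regionEdges ends F a₂ y ↔ e ∈ F ∧ ∃ v ∈ region ends F a₂ y, v ∈ ends e := by
  classical
  simp only [regionEdges]
  exact Finset.mem_filter

omit [Fintype E] in
/-- **The red connection `a₁ ↔ b` survives the region swap when `a₁` separates `b` from `a₂`.** -/
theorem conn_swapRegion_of_sep {ends : E → Sym2 V} {F : Finset E} {a₁ a₂ b : V}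
    (hsep : ¬ Conn ends (offRoot ends a₁) a₂ b) {y : Config E}
    (hQ : ¬ Conn ends y a₂ a₁) (hQ' : ¬ Conn ends (A3InactiveTyped.flipOn F y) a₂ a₁)
    (hb : Conn ends y a₁ b) : Conn ends (swapRegion ends F a₂ y) a₁ b := by
  have ha : a₂ ≠ a₁ := fun h => hQ (h ▸ conn_refl ends y a₂)
  -- the configuration with the region edges closed
  let y₁ : Config E := fun e => if e ∈ regionEdges ends F a₂ y then false else y e
  have hle : y₁ ≤ swapRegion ends F a₂ y := by
    intro e
    by_cases he : e ∈ regionEdges ends F a₂ y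
    · simp [y₁, he]
    · simp [y₁, he, swapRegion, A3InactiveTyped.flipOn]
  have hregion := region_subset_offRoot (F := F) hQ hQ'
  -- `b` is reached from `a₁` inside `cluster y₁ a₁ ∪ cluster offRoot a₂`
  have hS : b ∈ cluster ends y₁ a₁ ∪ cluster ends (offRoot ends a₁) a₂ := by
    refine mem_of_conn_of_closed (S := cluster ends y₁ a₁ ∪ cluster ends (offRoot ends a₁) a₂) ?_
      (Or.inl (mem_cluster_self ends y₁ a₁)) hb
    intro x hx u hxu
    obtain ⟨hne, e, he, hends⟩ := openGraph_adj.1 hxu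
    by_cases hx2 : x ∈ cluster ends (offRoot ends a₁) a₂
    · -- `x` is on `a₂`'s side of `a₁`: so is `u`, unless `u = a₁`
      by_cases hu1 : u = a₁
      · exact Or.inl (hu1 ▸ mem_cluster_self ends y₁ a₁)
      · have hnot : a₁ ∉ ends e := by
          intro hmem
          rw [hends, Sym2.mem_iff] at hmem
          rcases hmem with rfl | rfl
          · exact notMem_cluster_offRoot ha hx2
          · exact hu1 rfl
        exact Or.inr (mem_cluster_of_adj hx2 (openGraph_adj.2 ⟨hne, e, offRoot_eq_true hnot, hends⟩))
    · by_cases hu2 : u ∈ cluster ends (offRoot ends a₁) a₂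
      · exact Or.inr hu2
      · -- neither endpoint is in the region: the edge is not a region edge, hence open in `y₁`
        have hx1 : x ∈ cluster ends y₁ a₁ := hx.resolve_right hx2
        have hD : e ∉ regionEdges ends F a₂ y := by
          intro hD
          obtain ⟨_, v, hv, hve⟩ := mem_regionEdges_iff.1 hD
          rw [hends, Sym2.mem_iff] at hve
          rcases hve with rfl | rfl
          · exact hx2 (hregion hv)
          · exact hu2 (hregion hv)
        have he1 : y₁ e = true := by simp [y₁, hD, he]
        exact Or.inl (mem_cluster_of_adj hx1 (openGraph_adj.2 ⟨hne, e, he1, hends⟩))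
  rcases hS with hS | hS
  · exact conn_mono hle hS
  · exact absurd hS hsep

variable {R : Type*} [Field R]

/-- **Typed BHK 1.4 (single-vertex) with equality when `a₁` separates `b` from `a₂`**: at every
profile, `N(QAB, Q) = N(QB, QA)` (in particular `b` a leaf at `a₁`). -/
theorem tb14_of_sep (ends : E → Sym2 V) (a₁ a₂ b o : V) (F : Finset E) (z : Config E)
    (hsep : ¬ Conn ends (offRoot ends a₁) a₂ b) :
    pairCount F z (sameBO ends a₁ a₂ b o : Config E → Config E → R) =
      pairCount F z (crossBO ends a₁ a₂ b o) :=
  tb14_of_no_junction ends a₁ a₂ b o F z fun _ _ hQ hQ' hb =>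
    conn_swapRegion_of_sep hsep hQ hQ' hb

end Cut

section Iff

/-- **(TB14) is exactly the junction inequality**: typed BHK 1.4 for single-vertex events holds
(on every graph, marking and profile) iff the junction count `pairCount F z junctionBO` is `≤ 0`
at every profile — the statement of record of the open part of row 2′TB. -/
theorem TB14_iff_junction (R : Type*) [Field R] [LinearOrder R] [IsStrictOrderedRing R] :
    TB14 R ↔ ∀ (V E : Type) [Fintype V] [DecidableEq V] [Fintype E] [DecidableEq E]
      (ends : E → Sym2 V) (a₁ a₂ b o : V) (F : Finset E) (z : Config E),
      pairCount F z (junctionBO ends a₁ a₂ b o F : Config E → Config E → R) ≤ 0 := by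
  constructor
  · intro h V E _ _ _ _ ends a₁ a₂ b o F z
    rw [← tb14_slack_eq_junction]
    exact sub_nonpos.2 (h V E ends a₁ a₂ b o F z)
  · intro h V E _ _ _ _ ends a₁ a₂ b o F z
    have := h V E ends a₁ a₂ b o F z
    rw [← tb14_slack_eq_junction] at this
    exact sub_nonpos.1 this

end Iff

end TB14Fold

end Summit.Ventures.PercRepro2
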